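import Summits.CriticalPhenomena.PercolationContinuityZ3.Theorems.PercNearOneGluingNoHeavyLowerTailFourPointRowsLeFive

/-!
# `NoHeavyLowerTail` (crux stmt-CriticalPhenomena-4575): the two-point LIFT-TRANSFER inequality (S2) of prim-ineq-gen-6 (4-point form, connectivity
# target) holds on every weighted graph with at most five vertices, for ALL edge weights — kernel-checked, three-copy comb positive

Support file (prover seat `prim-bnk-1`, bounded-n kernel theorems; `--supports stmt-CriticalPhenomena-4575`; COMPUTATIONAL: two `checkC` evaluations use `native_decide`).

(S2) (prim-ineq-gen-6 g5, FINDING-G5 §4, "THE two-point target"; hypothesis-free; (S2) ⟹ (S1) ⟹ the pair case (T2) of the CSL level inequalities via BHK Thm 1.3):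
for vertices `x, y, a` and an increasing event `A` of the cluster of `a`,  `Cov(1{x ↔ a}, A) · μ(y ↮ a) ≥ μ(x ↔ y, y ↮ a) · Cov(1{y ↔ a}, A)`.
Its 4-point form (target `A = {a ↔ b}`):

  `(μ(x↔a, a↔b) − μ(x↔a)μ(a↔b)) · μ(y↮a)  ≥  μ(x↔y, y↮a) · (μ(y↔a, a↔b) − μ(y↔a)μ(a↔b))`,

0 violations in ≈ 1.3·10⁸ exact instances (exhaustive n ≤ 6 at nine weightings, gen-6 lab/kit_csl/exh.c), equality iff `{x↔y∨x↔a} ⊥ {y↔a}` and `{x↔a} ⊥ A` given `{y↔a}`;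
the stronger forms without the BHK term are false; no certificate known (LP search kit j075942).

**Theorem `liftTransfer_le_five`.**  The 4-point form holds for every `n ≤ 5`, every `w : Sym2 (Fin n) → [0,1]` and all pairwise distinct `x y a b : Fin n`.  PROOF: the signed cubic
(`ltTerms`, four products of connectivity-event probabilities) passes prim-cert-2's three-copy checker `checkC` at the standard quadruple of `K₄` (`2^22`) and `K₅` (`2^34`) — all
`4^6` resp. `4^10` tensor-Bernstein fibre sums are `≥ 0` (`K₅`: 893 611 zero / 154 965 positive, 0 negative; two independent exact C implementations agree,
run/shared/lean/prim/prim-l12/prim-bnk-1/) — and is transported along vertex relabellings.  So (S2)'s connectivity-target form is Richards-comb positive on `≤ 5` vertices (the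
signature of a copy-switching proof).  Nothing is claimed beyond five vertices or for other targets `A`.
-/

namespace Summit.CriticalPhenomena.PercolationContinuityZ3.Theorems.LiftTransfer

open Finset MeasureTheory OneCutCert CovTransferCert E3GroupSepCert
open scoped BigOperators
open Literature.Probability.Percolation Literature.Probability.LatticeModels

variable {n : ℕ}

/-- `{u ↔ v}`. [this work] -/
def pJ (u v : Fin n) : CRel n → Bool := fun r => r u v
/-- `{u ↮ v}`. [this work] -/
def pN (u v : Fin n) : CRel n → Bool := fun r => !(r u v)
/-- `{u ↔ v} ∩ {s ↔ t}`. [this work] -/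
def pJJ (u v s t : Fin n) : CRel n → Bool := fun r => r u v && r s t
/-- `{u ↔ v} ∩ {s ↮ t}`. [this work] -/
def pJN (u v s t : Fin n) : CRel n → Bool := fun r => r u v && !(r s t)

/-- The event of `pJ`. [this work] -/
theorem connEvent_pJ (u v : Fin n) : connEvent (pJ u v) = openConn u v := by
  ext ω; simp [connEvent, pJ]
/-- The event of `pN`. [this work] -/
theorem connEvent_pN (u v : Fin n) : connEvent (pN u v) = (openConn u v)ᶜ := by
  ext ω; simp [connEvent, pN]
/-- The event of `pJJ`. [this work] -/
theorem connEvent_pJJ (u v s t : Fin n) : connEvent (pJJ u v s t) = openConn u v ∩ openConn s t := by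
  ext ω; simp [connEvent, pJJ]
/-- The event of `pJN`. [this work] -/
theorem connEvent_pJN (u v s t : Fin n) : connEvent (pJN u v s t) = openConn u v ∩ (openConn s t)ᶜ := by
  ext ω; simp [connEvent, pJN]

/-- The signed cubic of the 4-point lift transfer at the quadruple `q = (x, y, a, b)`:
`σ·μ(x↔a ∧ a↔b)·μ(y↮a) − μ(x↔a)μ(a↔b)μ(y↮a) − σ·μ(x↔y ∧ y↮a)·μ(y↔a ∧ a↔b) + μ(x↔y ∧ y↮a)μ(y↔a)μ(a↔b)`. [this work] -/
def ltTerms (q : Quad n) : List (CTerm n) :=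
  let x := q.1
  let y := q.2.1
  let a := q.2.2.1
  let b := q.2.2.2
  [(1, pTrue, pJJ x a a b, pN y a), (-1, pJ x a, pJ a b, pN y a), (-1, pTrue, pJN x y y a, pJJ y a a b), (1, pJN x y y a, pJ y a, pJ a b)]

/-- The terms under relabelling. [this work] -/
theorem ltTerms_relP (τ : Fin n ≃ Fin n) (q : Quad n) :
    ((ltTerms q).map fun z => (z.1, relP τ z.2.1, relP τ z.2.2.1, relP τ z.2.2.2)) = ltTerms (quadmap τ q) := by
  obtain ⟨x, y, a, b⟩ := q
  rfl

/-- Transport along a relabelling. [this work] -/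
theorem lt_relabel (σ : Fin n ≃ Fin n) (w : Sym2 (Fin n) → unitInterval) (q : Quad n) (h : 0 ≤ cval w (ltTerms q)) :
    0 ≤ cval (relabelW σ w) (ltTerms (quadmap σ q)) := by
  rw [cval_map_relP, ltTerms_relP, quadmap_symm_quadmap]
  exact h

/-- Transport of validity at all weights. [this work] -/
theorem lt_forall_relabel (σ : Fin n ≃ Fin n) {q : Quad n} (h : ∀ w : Sym2 (Fin n) → unitInterval, 0 ≤ cval w (ltTerms q))
    (w : Sym2 (Fin n) → unitInterval) : 0 ≤ cval w (ltTerms (quadmap σ q)) := by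
  have hw : relabelW σ (fun e => w (sym2Equiv σ e)) = w := by
    funext e
    unfold relabelW
    simp only [Equiv.apply_symm_apply]
  rw [← hw]
  exact lt_relabel σ _ q (h _)

/-- `K₄`: the lift-transfer cubic passes the three-copy check (base `2^22`): all `4^6` fibre sums are `≥ 0`. [this work] -/
theorem checkLT4 : checkC 4 22 (ltTerms (quad₀ 4 le_rfl)) = true := by native_decide
/-- `K₅`: the lift-transfer cubic passes the three-copy check (base `2^34`): all `4^10` fibre sums are `≥ 0`. [this work] -/
theorem checkLT5 : checkC 5 34 (ltTerms (quad₀ 5 (by norm_num))) = true := by native_decide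

/-- The cubic (term form) on every weighted graph with at most five vertices. [this work] -/
theorem lt_cval_le_five : ∀ n ≤ 5, ∀ (w : Sym2 (Fin n) → unitInterval) (x y a b : Fin n),
    x ≠ y → x ≠ a → x ≠ b → y ≠ a → y ≠ b → a ≠ b → 0 ≤ cval w (ltTerms (x, y, a, b)) := by
  intro n hn w x y a b hxy hxa hxb hya hyb hab
  interval_cases n
  · exact x.elim0
  · exact absurd (Subsingleton.elim x y) hxy
  · have : a = x ∨ a = y := by omega
    rcases this with h | h
    · exact absurd h.symm hxa
    · exact absurd h.symm hya
  · have : b = x ∨ b = y ∨ b = a := by omega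
    rcases this with h | h | h
    · exact absurd h.symm hxb
    · exact absurd h.symm hyb
    · exact absurd h.symm hab
  · obtain ⟨σ, hσ⟩ := cover_quad4 _ (mem_distinctQuad hxy hxa hxb hya hyb hab)
    rw [← hσ]
    exact lt_forall_relabel σ (fun w' => checkC_sound 22 _ checkLT4 w') w
  · obtain ⟨σ, hσ⟩ := cover_quad5 _ (mem_distinctQuad hxy hxa hxb hya hyb hab)
    rw [← hσ]
    exact lt_forall_relabel σ (fun w' => checkC_sound 34 _ checkLT5 w') w

/-- **The 4-point lift-transfer inequality (S2) on at most five vertices.**  For every weighted graph on `n ≤ 5` vertices and all pairwise distinct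
`x y a b`:  `μ(x↔y, y↮a)·(μ(y↔a, a↔b) − μ(y↔a)μ(a↔b)) ≤ (μ(x↔a, a↔b) − μ(x↔a)μ(a↔b))·μ(y↮a)`  (`μ = prodBernoulli w`). [this work] -/
theorem liftTransfer_le_five : ∀ n ≤ 5, ∀ (w : Sym2 (Fin n) → unitInterval) (x y a b : Fin n),
    x ≠ y → x ≠ a → x ≠ b → y ≠ a → y ≠ b → a ≠ b →
    (prodBernoulli w).real (openConn x y ∩ (openConn y a)ᶜ) *
        ((prodBernoulli w).real (openConn y a ∩ openConn a b) - (prodBernoulli w).real (openConn y a) * (prodBernoulli w).real (openConn a b)) ≤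
      ((prodBernoulli w).real (openConn x a ∩ openConn a b) - (prodBernoulli w).real (openConn x a) * (prodBernoulli w).real (openConn a b)) *
        (prodBernoulli w).real (openConn y a)ᶜ := by
  intro n hn w x y a b hxy hxa hxb hya hyb hab
  have h := lt_cval_le_five n hn w x y a b hxy hxa hxb hya hyb hab
  unfold cval ltTerms at h
  simp only [List.map_cons, List.map_nil, List.sum_cons, List.sum_nil, pr_pTrue] at h
  unfold pr at h
  simp only [connEvent_pJ, connEvent_pN, connEvent_pJJ, connEvent_pJN] at h
  push_cast at h
  linarith

end Summit.CriticalPhenomena.PercolationContinuityZ3.Theorems.LiftTransfer
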